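import Mathlib.Analysis.Fourier.AddCircleMulti
import Mathlib.Topology.MetricSpace.UniformConvergence
import Mathlib.Analysis.Asymptotics.Lemmas
import Literature.NumberTheory.DiophantineApproximation.KroneckerWeyl
import HarnessLib

/-!
# Kronecker sequences on the torus: Weyl's theorem in `ℝˡ` and twisted sums

Topic `Literature/NumberTheory/UniformDistribution`. Everything in this file is PROVED; no named facts.

Source: L. Kuipers, H. Niederreiter, *Uniform distribution of sequences* (Wiley 1974), Ch. 1 §6
(u.d. mod 1 in `ℝˡ`, Weyl's criterion on the torus, Example 6.1: `(nθ₁, …, nθ_l)` is u.d. mod 1 iff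
`1, θ₁, …, θ_l` are linearly independent over `ℚ`) [KuipersNiederreiter1974]; restated as Theorem 2.1
of I. J. Håland, Acta Arith. 67 (1994) 13–27 [Haland1994, Thm 2.1, p. 14]: "Let
`x(n) = (x₁(n), …, x_l(n))` be a sequence in `ℝˡ`. Then the following statements are equivalent:
(i) `x(n)` is uniformly distributed (mod 1) in `ℝˡ`. (ii) `Σᵢ kᵢxᵢ(n)` is uniformly distributed
(mod 1) in `ℝ` for all `l`-tuples `(k₁, …, k_l) ≠ (0, …, 0)` of integers. (iii) For every Riemann
integrable function `f` on `[0, 1]ˡ`, `lim (1/N) Σ_{n<N} f({x(n)}) = ∫ f`."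

What is here (the torus is Mathlib's `UnitAddTorus ι = ι → AddCircle 1` with its Haar probability
measure `volume`; characters are `UnitAddTorus.mFourier ν`, `ν : ι → ℤ`):

* `mFourier_apply_coe` — `e_ν((xᵢ mod 1)ᵢ) = e(Σ νᵢ xᵢ)`.
* `tendsto_avg_comp_kronecker` — **Weyl's theorem for Kronecker sequences (criterion (iii) for
  continuous test functions)**: if `Σᵢ νᵢβᵢ ∉ ℤ` for every `ν ∈ ℤ^ι ∖ {0}` (equivalently `1, (βᵢ)` are
  `ℚ`-linearly independent), then for every continuous `F` on the torus and all phases `cᵢ`,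
  `(1/N) Σ_{n<N} F((βᵢ n + cᵢ)ᵢ) → ∫ F`. [KuipersNiederreiter1974, Ch. 1 §6, Example 6.1]
* `isLittleO_sum_mul_of_mFourier` — **twisted sums** (the use made of Thm 2.1 (ii)⇒(iii) in
  Håland's van der Corput method, p. 16): for ANY sequence `y` on the torus and weights `‖wₙ‖ ≤ 1`, if
  `Σ_{n<N} e_ν(yₙ) wₙ = o(N)` for every character `e_ν`, then `Σ_{n<N} F(yₙ) wₙ = o(N)` for every
  continuous `F`;
* `isLittleO_sum_mul_of_approx` — the same for any weight sequence `gₙ` that is approximable by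
  `F(yₙ)`, `F` continuous, in the sense `Σ_{n<N} ‖gₙ − F(yₙ)‖ ≤ εN` eventually (Riemann-integrable
  test functions along a u.d. sequence are of this kind).

## Proofs

Characters along the Kronecker sequence are geometric progressions with ratio `e(Σ νᵢβᵢ) ≠ 1`,
hence have bounded sums; the set of continuous `F` satisfying the conclusion is a linear subspace,
closed because the averaging functionals are `1`-Lipschitz (`Equicontinuous.isClosed_setOf_tendsto`),
and contains the characters, whose span is dense (`UnitAddTorus.span_mFourier_closure_eq_top`,
Stone–Weierstrass) — the argument of the tree's `KroneckerWeyl.tendsto_avg_integral_comp_flow` for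
flows, whose torus lemmas (`integral_mFourier`, `lipschitzWith_integral`) are reused.

## References

* [KuipersNiederreiter1974] L. Kuipers, H. Niederreiter, *Uniform distribution of sequences*, Wiley
  1974, Ch. 1 §6 (Thm 6.2, Thm 6.3, Example 6.1).
* [Haland1994] I. J. Håland, *Uniform distribution of generalized polynomials of the product type*,
  Acta Arith. 67 (1994) 13–27, Thm 2.1 (p. 14) and p. 16.
* [Weyl1916] H. Weyl, *Über die Gleichverteilung von Zahlen mod. Eins*, Math. Ann. 77 (1916) 313–352.
-/

noncomputable section

open Filter Topology Asymptotics Finset Complex MeasureTheory Set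
open Literature.NumberTheory.DiophantineApproximation

namespace Literature.NumberTheory.UniformDistribution

namespace KroneckerSeq

variable {ι : Type*} [Fintype ι]

/-! ### 1. Characters at real points of the torus -/

/-- `e_ν((xᵢ mod 1)ᵢ) = e(Σᵢ νᵢ xᵢ)` (`e(t) = exp(2πit)`). [folklore] -/
theorem mFourier_apply_coe (ν : ι → ℤ) (x : ι → ℝ) :
    UnitAddTorus.mFourier ν (fun i => ((x i : ℝ) : UnitAddCircle)) =
      cexp (2 * Real.pi * I * ((∑ i, (ν i : ℝ) * x i : ℝ) : ℂ)) := by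
  simp only [UnitAddTorus.mFourier, ContinuousMap.coe_mk, fourier_coe_apply]
  rw [← Complex.exp_sum]
  congr 1
  push_cast
  rw [Finset.mul_sum]
  refine Finset.sum_congr rfl fun i _ => ?_
  ring

/-- Along the Kronecker sequence `n ↦ (βᵢ n + cᵢ)ᵢ` the character `e_ν` is the geometric progression
`e(ν·c) · e(ν·β)ⁿ`. [folklore] -/
theorem mFourier_apply_kronecker (ν : ι → ℤ) (β c : ι → ℝ) (n : ℕ) :
    UnitAddTorus.mFourier ν (fun i => ((β i * n + c i : ℝ) : UnitAddCircle)) =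
      cexp (2 * Real.pi * I * ((∑ i, (ν i : ℝ) * c i : ℝ) : ℂ)) *
        cexp (2 * Real.pi * I * ((∑ i, (ν i : ℝ) * β i : ℝ) : ℂ)) ^ n := by
  rw [mFourier_apply_coe, ← Complex.exp_nat_mul, ← Complex.exp_add]
  congr 1
  push_cast
  rw [Finset.mul_sum, Finset.mul_sum, Finset.mul_sum, Finset.mul_sum, ← Finset.sum_add_distrib]
  refine Finset.sum_congr rfl fun i _ => ?_
  ring

/-! ### 2. Averages of characters along a Kronecker sequence -/

/-- `e(t) ≠ 1` when `t` is not an integer. [folklore] -/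
theorem cexp_ne_one_of_forall_ne_int {t : ℝ} (ht : ∀ z : ℤ, t ≠ z) :
    cexp (2 * Real.pi * I * (t : ℂ)) ≠ 1 := by
  intro h1
  obtain ⟨m, hm⟩ := Complex.exp_eq_one_iff.1 h1
  have h2πI : (2 * Real.pi * I : ℂ) ≠ 0 := by
    refine mul_ne_zero (mul_ne_zero two_ne_zero ?_) I_ne_zero
    exact_mod_cast Real.pi_ne_zero
  have : (2 * Real.pi * I) * (t : ℂ) = (2 * Real.pi * I) * (m : ℂ) := by rw [hm]; ring
  have := mul_left_cancel₀ h2πI this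
  exact ht m (by exact_mod_cast this)

/-- Geometric sums with ratio `q ≠ 1` of norm `1` are bounded: `‖Σ_{n<N} qⁿ‖ ≤ 2/‖q − 1‖`.
[folklore] -/
theorem norm_geom_sum_le {q : ℂ} (hq : ‖q‖ = 1) (hq1 : q ≠ 1) (N : ℕ) :
    ‖∑ n ∈ range N, q ^ n‖ ≤ 2 / ‖q - 1‖ := by
  rw [geom_sum_eq hq1, norm_div]
  gcongr
  refine (norm_sub_le _ _).trans ?_
  rw [norm_pow, hq, one_pow, norm_one]
  norm_num

/-- **Weyl's criterion on the torus, character case**: if `Σᵢ νᵢβᵢ ∉ ℤ` for all `ν ≠ 0`, then for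
every `ν` the averages of `e_ν` along `(βᵢn + cᵢ)ᵢ` converge to `∫ e_ν = [ν = 0]`.
[cite: KuipersNiederreiter1974, Ch. 1 §6, Example 6.1] -/
theorem tendsto_avg_mFourier {β : ι → ℝ} (hβ : ∀ ν : ι → ℤ, ν ≠ 0 → ∀ z : ℤ, ∑ i, (ν i : ℝ) * β i ≠ z)
    (c : ι → ℝ) (ν : ι → ℤ) :
    Tendsto (fun N : ℕ => (∑ n ∈ range N,
        UnitAddTorus.mFourier ν (fun i => ((β i * n + c i : ℝ) : UnitAddCircle))) / (N : ℂ))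
      atTop (𝓝 (∫ x : UnitAddTorus ι, UnitAddTorus.mFourier ν x)) := by
  rw [KroneckerWeyl.integral_mFourier]
  by_cases hν : ν = 0
  · subst hν
    rw [if_pos rfl]
    simp only [UnitAddTorus.mFourier_zero, ContinuousMap.one_apply, sum_const, card_range,
      nsmul_eq_mul, mul_one]
    refine tendsto_const_nhds.congr' ?_
    filter_upwards [eventually_ne_atTop 0] with N hN
    rw [div_self]
    exact_mod_cast hN
  · rw [if_neg hν]
    simp_rw [mFourier_apply_kronecker, ← Finset.mul_sum, mul_div_assoc]
    set q : ℂ := cexp (2 * Real.pi * I * ((∑ i, (ν i : ℝ) * β i : ℝ) : ℂ)) with hq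
    have hq1 : q ≠ 1 := cexp_ne_one_of_forall_ne_int (hβ ν hν)
    have hqn : ‖q‖ = 1 := by
      rw [hq, Complex.norm_exp]
      simp
    rw [show (0 : ℂ) = cexp (2 * Real.pi * I * ((∑ i, (ν i : ℝ) * c i : ℝ) : ℂ)) * 0 by simp]
    refine Tendsto.const_mul _ ?_
    -- bounded / N → 0
    have hb : ∀ N : ℕ, ‖(∑ n ∈ range N, q ^ n) / (N : ℂ)‖ ≤ (2 / ‖q - 1‖) * ‖(1 : ℝ) / N‖ := by
      intro N
      rw [norm_div, Complex.norm_natCast, Real.norm_eq_abs, abs_of_nonneg (by positivity),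
        div_eq_mul_one_div]
      gcongr
      exact norm_geom_sum_le hqn hq1 N
    refine squeeze_zero_norm hb ?_
    rw [show (0 : ℝ) = 2 / ‖q - 1‖ * ‖(0 : ℝ)‖ by simp]
    exact (tendsto_one_div_atTop_nhds_zero_nat.norm).const_mul _

/-! ### 3. The averaging functionals are `1`-Lipschitz -/

omit [Fintype ι] in
/-- For any sequence `y` on the torus and any `N`, `F ↦ (1/N) Σ_{n<N} F(yₙ) wₙ` is `1`-Lipschitz on
`C(𝕋, ℂ)` when `‖wₙ‖ ≤ 1`. [folklore] -/
theorem lipschitzWith_avg_mul (y : ℕ → UnitAddTorus ι) {w : ℕ → ℂ} (hw : ∀ n, ‖w n‖ ≤ 1) (N : ℕ) :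
    LipschitzWith 1 (fun F : C(UnitAddTorus ι, ℂ) => (∑ n ∈ range N, F (y n) * w n) / (N : ℂ)) := by
  refine LipschitzWith.of_dist_le_mul fun F G => ?_
  rw [NNReal.coe_one, one_mul, dist_eq_norm, dist_eq_norm, ← sub_div, ← Finset.sum_sub_distrib]
  by_cases hN : N = 0
  · subst hN
    simp
  have hN' : (0 : ℝ) < N := by exact_mod_cast Nat.pos_of_ne_zero hN
  rw [norm_div, Complex.norm_natCast, div_le_iff₀ hN']
  calc ‖∑ n ∈ range N, (F (y n) * w n - G (y n) * w n)‖
      ≤ ∑ n ∈ range N, ‖F (y n) * w n - G (y n) * w n‖ := norm_sum_le _ _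
    _ ≤ ∑ _n ∈ range N, ‖F - G‖ := by
        refine Finset.sum_le_sum fun n _ => ?_
        rw [← sub_mul, norm_mul]
        have h1 : ‖F (y n) - G (y n)‖ ≤ ‖F - G‖ := (F - G).norm_coe_le_norm (y n)
        have h2 := hw n
        have h3 := norm_nonneg (F (y n) - G (y n))
        have h4 := norm_nonneg (w n)
        nlinarith
    _ = ‖F - G‖ * N := by rw [sum_const, card_range, nsmul_eq_mul, mul_comm]

omit [Fintype ι] in
/-- The plain averaging functional `F ↦ (1/N) Σ_{n<N} F(yₙ)` is `1`-Lipschitz. [folklore] -/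
theorem lipschitzWith_avg (y : ℕ → UnitAddTorus ι) (N : ℕ) :
    LipschitzWith 1 (fun F : C(UnitAddTorus ι, ℂ) => (∑ n ∈ range N, F (y n)) / (N : ℂ)) := by
  have := lipschitzWith_avg_mul y (w := fun _ => 1) (fun n => by simp) N
  simpa using this

/-! ### 4. Weyl's theorem for Kronecker sequences (continuous test functions) -/

/-- **Weyl's equidistribution theorem on the torus**: if `Σᵢ νᵢβᵢ ∉ ℤ` for every `ν ∈ ℤ^ι ∖ {0}`
(i.e. `1, (βᵢ)ᵢ` linearly independent over `ℚ`), then the Kronecker sequence `((βᵢ n + cᵢ) mod 1)ᵢ`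
is uniformly distributed in the torus: `(1/N) Σ_{n<N} F((βᵢn + cᵢ)ᵢ) → ∫ F` for every continuous
`F`. (Kuipers–Niederreiter Ch. 1, Example 6.1 with Thm 6.2/6.3; Håland 1994, Thm 2.1 (i)⇔(iii) for
continuous `f`.) [cite: KuipersNiederreiter1974, Ch. 1 §6, Example 6.1] -/
theorem tendsto_avg_comp_kronecker {β : ι → ℝ}
    (hβ : ∀ ν : ι → ℤ, ν ≠ 0 → ∀ z : ℤ, ∑ i, (ν i : ℝ) * β i ≠ z) (c : ι → ℝ)
    (F : C(UnitAddTorus ι, ℂ)) :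
    Tendsto (fun N : ℕ => (∑ n ∈ range N,
        F (fun i => ((β i * n + c i : ℝ) : UnitAddCircle))) / (N : ℂ))
      atTop (𝓝 (∫ x : UnitAddTorus ι, F x)) := by
  set y : ℕ → UnitAddTorus ι := fun n i => ((β i * n + c i : ℝ) : UnitAddCircle) with hy
  set S : Set C(UnitAddTorus ι, ℂ) := {F | Tendsto (fun N : ℕ => (∑ n ∈ range N, F (y n)) / (N : ℂ))
      atTop (𝓝 (∫ x : UnitAddTorus ι, F x))} with hS
  have hclosed : IsClosed S := by
    have heq : Equicontinuous (fun (N : ℕ) (F : C(UnitAddTorus ι, ℂ)) =>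
        (∑ n ∈ range N, F (y n)) / (N : ℂ)) :=
      (LipschitzWith.uniformEquicontinuous _ 1 (lipschitzWith_avg y)).equicontinuous
    exact heq.isClosed_setOf_tendsto KroneckerWeyl.lipschitzWith_integral.continuous
  have hspan : (Submodule.span ℂ (Set.range (UnitAddTorus.mFourier (d := ι))) :
      Set C(UnitAddTorus ι, ℂ)) ⊆ S := by
    intro G hG
    induction hG using Submodule.span_induction with
    | mem G hG =>
      obtain ⟨ν, rfl⟩ := hG
      exact tendsto_avg_mFourier hβ c ν
    | zero =>
      simp only [hS, mem_setOf_eq, ContinuousMap.zero_apply, sum_const_zero, zero_div,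
        integral_zero]
      exact tendsto_const_nhds
    | add G₁ G₂ _ _ h₁ h₂ =>
      simp only [hS, mem_setOf_eq, ContinuousMap.add_apply] at h₁ h₂ ⊢
      simp_rw [sum_add_distrib, add_div]
      rw [integral_add (KroneckerWeyl.integrable_continuousMap G₁)
        (KroneckerWeyl.integrable_continuousMap G₂)]
      exact h₁.add h₂
    | smul a G _ h =>
      simp only [hS, mem_setOf_eq, ContinuousMap.smul_apply, smul_eq_mul] at h ⊢
      simp_rw [← Finset.mul_sum, mul_div_assoc]
      rw [integral_const_mul]
      exact h.const_mul a
  have htop : F ∈ ((Submodule.span ℂ (Set.range (UnitAddTorus.mFourier (d := ι)))).topologicalClosure :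
      Set C(UnitAddTorus ι, ℂ)) := by
    rw [UnitAddTorus.span_mFourier_closure_eq_top]; trivial
  rw [Submodule.topologicalClosure_coe] at htop
  exact hclosed.closure_subset_iff.2 hspan htop

/-- Real-valued form of Weyl's theorem for Kronecker sequences.
[cite: KuipersNiederreiter1974, Ch. 1 §6, Example 6.1] -/
theorem tendsto_avg_comp_kronecker_real {β : ι → ℝ}
    (hβ : ∀ ν : ι → ℤ, ν ≠ 0 → ∀ z : ℤ, ∑ i, (ν i : ℝ) * β i ≠ z) (c : ι → ℝ)
    (F : C(UnitAddTorus ι, ℝ)) :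
    Tendsto (fun N : ℕ => (∑ n ∈ range N,
        F (fun i => ((β i * n + c i : ℝ) : UnitAddCircle))) / (N : ℝ))
      atTop (𝓝 (∫ x : UnitAddTorus ι, F x)) := by
  set Fc : C(UnitAddTorus ι, ℂ) := (⟨Complex.ofReal, Complex.continuous_ofReal⟩ : C(ℝ, ℂ)).comp F
    with hFc
  have h := tendsto_avg_comp_kronecker hβ c Fc
  have h2 := (Complex.continuous_re.tendsto _).comp h
  simp only [hFc, ContinuousMap.comp_apply, ContinuousMap.coe_mk, Function.comp_def] at h2
  convert h2 using 2 with N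
  · rw [← Complex.ofReal_sum, ← Complex.ofReal_natCast, ← Complex.ofReal_div, Complex.ofReal_re]
  · rw [integral_complex_ofReal, Complex.ofReal_re]

/-- A convenient form of the independence hypothesis: if `1, β₁, …` are linearly independent over
`ℚ` in the sense that `a + Σᵢ bᵢβᵢ = 0` with `a, bᵢ ∈ ℤ` forces `b = 0`, stated as the character
condition used above. (From `LinearIndependent ℚ (Fin.cons 1 β)`-type hypotheses one gets this by
clearing denominators; we record the elementary direction actually needed.) [folklore] -/
theorem forall_ne_int_of_forall_sum_ne {β : ι → ℝ}
    (h : ∀ (ν : ι → ℤ) (z : ℤ), (∑ i, (ν i : ℝ) * β i) + z = 0 → ν = 0) :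
    ∀ ν : ι → ℤ, ν ≠ 0 → ∀ z : ℤ, ∑ i, (ν i : ℝ) * β i ≠ z := by
  intro ν hν z hz
  exact hν (h ν (-z) (by rw [hz]; push_cast; ring))

/-! ### 5. Twisted sums: from characters to continuous functions -/

omit [Fintype ι] in
/-- `o(N)` for complex-valued sums over `range N` is the same as the averages tending to `0`.
[folklore] -/
theorem isLittleO_iff_tendsto_avg (f : ℕ → ℂ) :
    (f =o[atTop] fun N : ℕ => (N : ℝ)) ↔ Tendsto (fun N : ℕ => f N / (N : ℂ)) atTop (𝓝 0) := by
  have h1 : (f =o[atTop] fun N : ℕ => (N : ℝ)) ↔ (f =o[atTop] fun N : ℕ => (N : ℂ)) :=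
    ⟨fun h => (h.congr_right fun N => (Complex.norm_natCast N).symm).of_norm_right,
     fun h => h.norm_right.congr_right fun N => Complex.norm_natCast N⟩
  rw [h1]
  refine Asymptotics.isLittleO_iff_tendsto' ?_
  filter_upwards [eventually_ne_atTop 0] with N hN hN0
  exact absurd (by exact_mod_cast hN0 : N = 0) hN

/-- **Twisted sums along a sequence on the torus** (the mechanism of Håland 1994, p. 16, via
Thm 2.1): let `y` be any sequence on the torus and `‖wₙ‖ ≤ 1`. If `Σ_{n<N} e_ν(yₙ) wₙ = o(N)` for
every character `e_ν`, `ν ∈ ℤ^ι`, then `Σ_{n<N} F(yₙ) wₙ = o(N)` for every continuous `F` on the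
torus. [cite: Haland1994, Thm 2.1 and p. 16] -/
theorem isLittleO_sum_mul_of_mFourier {y : ℕ → UnitAddTorus ι} {w : ℕ → ℂ} (hw : ∀ n, ‖w n‖ ≤ 1)
    (h : ∀ ν : ι → ℤ, (fun N : ℕ => ∑ n ∈ range N, UnitAddTorus.mFourier ν (y n) * w n)
      =o[atTop] fun N : ℕ => (N : ℝ))
    (F : C(UnitAddTorus ι, ℂ)) :
    (fun N : ℕ => ∑ n ∈ range N, F (y n) * w n) =o[atTop] fun N : ℕ => (N : ℝ) := by
  rw [isLittleO_iff_tendsto_avg]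
  set S : Set C(UnitAddTorus ι, ℂ) := {F | Tendsto (fun N : ℕ =>
      (∑ n ∈ range N, F (y n) * w n) / (N : ℂ)) atTop (𝓝 ((fun _ => (0 : ℂ)) F))} with hS
  have hclosed : IsClosed S := by
    have heq : Equicontinuous (fun (N : ℕ) (F : C(UnitAddTorus ι, ℂ)) =>
        (∑ n ∈ range N, F (y n) * w n) / (N : ℂ)) :=
      (LipschitzWith.uniformEquicontinuous _ 1 (lipschitzWith_avg_mul y hw)).equicontinuous
    exact heq.isClosed_setOf_tendsto continuous_const
  have hspan : (Submodule.span ℂ (Set.range (UnitAddTorus.mFourier (d := ι))) :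
      Set C(UnitAddTorus ι, ℂ)) ⊆ S := by
    intro G hG
    induction hG using Submodule.span_induction with
    | mem G hG =>
      obtain ⟨ν, rfl⟩ := hG
      exact (isLittleO_iff_tendsto_avg _).1 (h ν)
    | zero =>
      simp only [hS, mem_setOf_eq, ContinuousMap.zero_apply, zero_mul, sum_const_zero, zero_div]
      exact tendsto_const_nhds
    | add G₁ G₂ _ _ h₁ h₂ =>
      simp only [hS, mem_setOf_eq, ContinuousMap.add_apply] at h₁ h₂ ⊢
      simp_rw [add_mul, sum_add_distrib, add_div]
      simpa using h₁.add h₂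
    | smul a G _ h =>
      simp only [hS, mem_setOf_eq, ContinuousMap.smul_apply, smul_eq_mul] at h ⊢
      simp_rw [mul_assoc, ← Finset.mul_sum, mul_div_assoc]
      simpa using h.const_mul a
  have htop : F ∈ ((Submodule.span ℂ (Set.range (UnitAddTorus.mFourier (d := ι)))).topologicalClosure :
      Set C(UnitAddTorus ι, ℂ)) := by
    rw [UnitAddTorus.span_mFourier_closure_eq_top]; trivial
  rw [Submodule.topologicalClosure_coe] at htop
  exact hclosed.closure_subset_iff.2 hspan htop

/-! ### 6. Twisted sums with Riemann-integrable-type weights -/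

omit [Fintype ι] in
/-- **Twisted sums with approximable weights**: let `y` be any sequence on the torus, `‖wₙ‖ ≤ 1`,
and suppose `Σ_{n<N} e_ν(yₙ) wₙ = o(N)` for every character. If the weights `gₙ` are approximable
along `y` by continuous functions — for every `ε > 0` there is a continuous `F` with
`Σ_{n<N} ‖gₙ − F(yₙ)‖ ≤ εN` for all large `N` (e.g. `gₙ = G(yₙ)` with `G` Riemann integrable and `y`
u.d.) — then `Σ_{n<N} gₙ wₙ = o(N)`. [cite: Haland1994, Thm 2.1 (iii) and p. 16] -/
theorem isLittleO_sum_mul_of_approx [Fintype ι] {y : ℕ → UnitAddTorus ι} {w : ℕ → ℂ}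
    (hw : ∀ n, ‖w n‖ ≤ 1)
    (h : ∀ ν : ι → ℤ, (fun N : ℕ => ∑ n ∈ range N, UnitAddTorus.mFourier ν (y n) * w n)
      =o[atTop] fun N : ℕ => (N : ℝ))
    {g : ℕ → ℂ} (hg : ∀ ε : ℝ, 0 < ε → ∃ F : C(UnitAddTorus ι, ℂ),
      ∀ᶠ N : ℕ in atTop, ∑ n ∈ range N, ‖g n - F (y n)‖ ≤ ε * N) :
    (fun N : ℕ => ∑ n ∈ range N, g n * w n) =o[atTop] fun N : ℕ => (N : ℝ) := by
  rw [isLittleO_iff]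
  intro ε hε
  obtain ⟨F, hF⟩ := hg (ε / 2) (half_pos hε)
  have hmain := (isLittleO_iff.1 (isLittleO_sum_mul_of_mFourier hw h F)) (half_pos hε)
  filter_upwards [hF, hmain] with N hFN hmN
  rw [Real.norm_natCast] at hmN ⊢
  have hsplit : ∑ n ∈ range N, g n * w n =
      ∑ n ∈ range N, (g n - F (y n)) * w n + ∑ n ∈ range N, F (y n) * w n := by
    rw [← sum_add_distrib]
    refine Finset.sum_congr rfl fun n _ => by ring
  rw [hsplit]
  refine (norm_add_le _ _).trans ?_
  have h1 : ‖∑ n ∈ range N, (g n - F (y n)) * w n‖ ≤ ε / 2 * N := by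
    refine (norm_sum_le _ _).trans (le_trans ?_ hFN)
    refine Finset.sum_le_sum fun n _ => ?_
    rw [norm_mul]
    have := hw n
    have := norm_nonneg (g n - F (y n))
    have := norm_nonneg (w n)
    nlinarith
  linarith

end KroneckerSeq

end Literature.NumberTheory.UniformDistribution

end
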